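import Mathlib
import Summits.SmoothPoincare4.SmoothPoincare4.Theses.SullivanDual
import Literature.Geometry.Symplectic.StandardEnd
import Literature.Geometry.Symplectic.JHolomorphicMap
import Summits.SmoothPoincare4.SmoothPoincare4.Theorems.SullivanDualTameOrBrodyR4Reduction
import Summits.SmoothPoincare4.SmoothPoincare4.Theorems.SullivanDualTameOrBrodyR4PencilDefs
import Summits.SmoothPoincare4.SmoothPoincare4.Theorems.SullivanDualTameOrBrodyR4ContinuityMethod
import Summits.SmoothPoincare4.SmoothPoincare4.Theorems.SullivanDualTameOrBrodyR4DeepReduction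
import Summits.SmoothPoincare4.SmoothPoincare4.Theorems.SullivanDualTameOrBrodyR4StubTransversePencil
import Summits.SmoothPoincare4.SmoothPoincare4.Theorems.SullivanDualTameOrBrodyR4HelperContinuityOfUniqueness
import Summits.SmoothPoincare4.SmoothPoincare4.Theorems.SullivanDualTameOrBrodyR4HelperEmbeddedLimitsOfImmersed

/-!
# Reduction of the crux `TameOrBrodyR4` to local families + uniqueness of members + immersed limits (stmt-SmoothPoincare4-7826, line `Sketch`, skeleton v16 §3 — lead prover file)

The crux — every `C^∞` almost complex structure `J` on `ℝ⁴` standard on `‖x‖ ≥ R` is tamed by a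
`C^∞` closed 2-form equal to `ω₀` outside a ball OR carries a bounded non-constant entire `J`-curve
(`Summit.SmoothPoincare4.SmoothPoincare4.Theses.SullivanDual.TameOrBrodyR4`) — was reduced in
`…DeepReduction.lean` to FOUR deep predicates, in `…DeepReduction3.lean` to THREE (transversality
being the theorem `stub_transversePencil`) and in `…DeepReduction4.lean` disjointness of members was
removed (`helper_continuityOfUniqueness`). This file performs RESHAPE #3 of the line skeleton
(v16): the INJECTIVITY half of `HasEmbeddedLimits` is not an input either — an immersed
`C¹_loc`-limit of embedded members is injective (`helper_embeddedLimitsOfImmersed`: intersection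
dichotomy for two sheets of a `J`-curve via coordinates adapted to one sheet and the local
similarity principle, persistence of isolated intersections under `C¹_loc`-convergence, and a
clopen coincidence-set argument). Hence the crux is proved here, KERNEL-CHECKED and sorry-free,
from exactly THREE hypotheses, each VERBATIM the registered signature of a deep stub of the
skeleton `Cruxes/TameOrBrodyR4/Lines/Sketch.lean` (v16), universally quantified over
`(J, R, P, Q, eP, eQ)`:

* `hLF` = `stub_localFamily`: `HasLocalFamilies J R P Q` (automatic transversality with the point
  constraint at infinity; Hofer–Lizan–Sikorav 1997, Wendl 2018 Thm 2.44–2.46, McDuff–Salamon 2012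
  Thm 3.1.5);
* `hU` = `stub_uniqueMembers`: two normalised members with the same asymptotic value coincide
  (positivity of intersections at the point at infinity, `A·A = 0`);
* `hIL` = `stub_immersedLimits`: a `C¹_loc`-limit of members with the member properties at infinity
  is IMMERSED (no cusp forms in the limit: the local δ-invariant of a singular point of a
  `J`-curve is positive; McDuff 1991, Micallef–White 1995, McDuff–Salamon 2012 App. E).

`pencilsOrBlowup₃_of_deep3i` gives Gromov's two complete anchored pencils at radius `3R` or blow-up
data; `TameOrBrodyR4_of_deep3i` concludes through the landed `Reduction.anchorsOrBlowup_of`,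
`stub_chartOfAnchors`, `stub_chartTames`, `stub_gluing`, `helper_curveOfBlowup`; the registered arrow
form is `helper_reductionToLocalUniqueImmersed`.

References: M. Gromov, Invent. Math. 82 (1985), §2.4.A; H. Hofer, V. Lizan, J.-C. Sikorav,
J. Geom. Anal. 7 (1997); C. Wendl, LNM 2216 (2018); D. McDuff, D. Salamon, *J-holomorphic curves
and symplectic topology*, 2nd ed. (2012).
-/

-- the registered namespace `Summit.SmoothPoincare4.SmoothPoincare4.…` repeats a component
set_option linter.dupNamespace false

noncomputable section

open scoped ContDiff Topology InnerProductSpace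
open Filter Set Literature.Geometry.Symplectic

namespace Summit.SmoothPoincare4.SmoothPoincare4.Cruxes.TameOrBrodyR4.Sketch

/-- Local notation for the model space `ℝ⁴ = EuclideanSpace ℝ (Fin 4)`. -/
local notation "E4" => EuclideanSpace ℝ (Fin 4)

/-- **The research core at radius `3R` from local families, uniqueness of members and immersed
limits**: `helper_continuityOfUniqueness` for the frames `(z, w)` and `(w, z)` gives the two complete pencils (or blow-up data); clause (T) of the
core is the theorem `stub_transversePencil` for the pencil `F` against the members `G c`. -/
theorem pencilsOrBlowup₃_of_deep3i
    (hLF : ∀ (J : E4 → E4 →L[ℝ] E4) (R : ℝ) (P Q : E4 →L[ℝ] ℂ) (eP eQ : ℂ →L[ℝ] E4),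
      0 < R → ContDiff ℝ ∞ J → (∀ x v, J x (J x v) = -v) → IsCoordFrame P Q eP eQ →
      (∀ x : E4, R ≤ ‖x‖ → ∀ v, P (J x v) = Complex.I * P v) →
      (∀ x : E4, R ≤ ‖x‖ → ∀ v, Q (J x v) = Complex.I * Q v) → HasLocalFamilies J R P Q)
    (hU : ∀ (J : E4 → E4 →L[ℝ] E4) (R : ℝ) (P Q : E4 →L[ℝ] ℂ) (eP eQ : ℂ →L[ℝ] E4),
      0 < R → ContDiff ℝ ∞ J → (∀ x v, J x (J x v) = -v) → IsCoordFrame P Q eP eQ →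
      (∀ x : E4, R ≤ ‖x‖ → ∀ v, P (J x v) = Complex.I * P v) →
      (∀ x : E4, R ≤ ‖x‖ → ∀ v, Q (J x v) = Complex.I * Q v) →
      ∀ (b : ℂ) (u u' : ℂ → E4), IsPencilMember J R P Q b u → IsPencilMember J R P Q b u' → u = u')
    (hIL : ∀ (J : E4 → E4 →L[ℝ] E4) (R : ℝ) (P Q : E4 →L[ℝ] ℂ) (eP eQ : ℂ →L[ℝ] E4),
      0 < R → ContDiff ℝ ∞ J → (∀ x v, J x (J x v) = -v) → IsCoordFrame P Q eP eQ →
      (∀ x : E4, R ≤ ‖x‖ → ∀ v, P (J x v) = Complex.I * P v) →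
      (∀ x : E4, R ≤ ‖x‖ → ∀ v, Q (J x v) = Complex.I * Q v) →
      ∀ (b : ℕ → ℂ) (u : ℕ → ℂ → E4) (bs : ℂ) (v : ℂ → E4),
      (∀ n, IsPencilMember J R P Q (b n) (u n)) → Tendsto b atTop (𝓝 bs) →
      ContDiff ℝ ∞ v → IsJHolomorphicFlat J v →
      TendstoLocallyUniformly u v atTop →
      TendstoLocallyUniformly (fun n => fderiv ℝ (u n)) (fderiv ℝ v) atTop →
      Tendsto (fun ξ => Q (v ξ)) (cocompact ℂ) (𝓝 bs) →
      Tendsto (fun ξ => P (v ξ) - ξ) (cocompact ℂ) (𝓝 0) →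
      (∀ c : ℂ, 2 * R < ‖c‖ → ∃! ξ, P (v ξ) = c) →
      (∀ ξ : ℂ, 2 * R < ‖P (v ξ)‖ → Function.Bijective (fderiv ℝ (fun ξ => P (v ξ)) ξ)) →
      ∀ ξ : ℂ, Function.Injective (fderiv ℝ v ξ))
    (J : E4 → E4 →L[ℝ] E4) (R : ℝ) (hR : 0 < R)
    (hJs : ContDiff ℝ ∞ J) (hJ2 : ∀ x v, J x (J x v) = -v)
    (hJi : ∀ x : E4, R ≤ ‖x‖ → ∀ a b : E4, ⟪J x a, b⟫_ℝ = stdSymplecticForm a b) :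
    (∃ F G : ℂ → ℂ → E4,
      ContDiff ℝ ∞ (fun p : ℂ × ℂ => F p.1 p.2) ∧ ContDiff ℝ ∞ (fun p : ℂ × ℂ => G p.1 p.2) ∧
      Function.Bijective (fun p : ℂ × ℂ => F p.1 p.2) ∧
      Function.Bijective (fun p : ℂ × ℂ => G p.1 p.2) ∧
      (∀ p : ℂ × ℂ, Function.Bijective (fderiv ℝ (fun p : ℂ × ℂ => F p.1 p.2) p)) ∧
      (∀ p : ℂ × ℂ, Function.Bijective (fderiv ℝ (fun p : ℂ × ℂ => G p.1 p.2) p)) ∧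
      (∀ b, IsJHolomorphicFlat J (F b)) ∧ (∀ c, IsJHolomorphicFlat J (G c)) ∧
      (∀ b : ℂ, 3 * R ≤ ‖b‖ → ∀ ξ, Complex.mk (F b ξ 2) (F b ξ 3) = b) ∧
      (∀ x : E4, 3 * R ≤ ‖Complex.mk (x 2) (x 3)‖ → ∃ ξ, F (Complex.mk (x 2) (x 3)) ξ = x) ∧
      (∀ c : ℂ, 3 * R ≤ ‖c‖ → ∀ η, Complex.mk (G c η 0) (G c η 1) = c) ∧
      (∀ x : E4, 3 * R ≤ ‖Complex.mk (x 0) (x 1)‖ → ∃ η, G (Complex.mk (x 0) (x 1)) η = x) ∧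
      (∀ b c : ℂ, 3 * R ≤ ‖c‖ → ∃! ξ, Complex.mk (F b ξ 0) (F b ξ 1) = c) ∧
      (∀ b ξ : ℂ, 3 * R ≤ ‖Complex.mk (F b ξ 0) (F b ξ 1)‖ →
        Function.Bijective (fderiv ℝ (fun ξ => Complex.mk (F b ξ 0) (F b ξ 1)) ξ)) ∧
      (∀ c b : ℂ, 3 * R ≤ ‖b‖ → ∃! η, Complex.mk (G c η 2) (G c η 3) = b) ∧
      (∀ c η : ℂ, 3 * R ≤ ‖Complex.mk (G c η 2) (G c η 3)‖ →
        Function.Bijective (fderiv ℝ (fun η => Complex.mk (G c η 2) (G c η 3)) η)) ∧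
      (∀ b, Tendsto (fun ξ => Complex.mk (F b ξ 2) (F b ξ 3)) (cocompact ℂ) (𝓝 b)) ∧
      (∀ c, Tendsto (fun η => Complex.mk (G c η 0) (G c η 1)) (cocompact ℂ) (𝓝 c)) ∧
      (∀ b ξ c η, F b ξ = G c η → ∀ v v' : ℂ,
        fderiv ℝ (F b) ξ v = fderiv ℝ (G c) η v' → v = 0)) ∨
    (∃ (K : Set E4) (f : ℕ → ℂ → E4), IsCompact K ∧ (∀ n, ContDiff ℝ ∞ (f n)) ∧
      (∀ n, IsJHolomorphicFlat J (f n)) ∧ (∀ n (z : ℂ), ‖z‖ ≤ 1 → f n z ∈ K) ∧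
      Tendsto (fun n => ‖fderiv ℝ (f n) 0‖) atTop atTop) := by
  obtain ⟨Z, W, eZ, eW, hZ, hW, hF1, hF2⟩ := exists_frames
  have hJZ : ∀ x : E4, R ≤ ‖x‖ → ∀ v, Z (J x v) = Complex.I * Z v := fun x hx v => by
    rw [hZ, hZ]; exact (Reduction.coordinate_J_mul (hJi x hx) v).1
  have hJW : ∀ x : E4, R ≤ ‖x‖ → ∀ v, W (J x v) = Complex.I * W v := fun x hx v => by
    rw [hW, hW]; exact (Reduction.coordinate_J_mul (hJi x hx) v).2
  have h23 : ∀ {c : ℂ}, 3 * R ≤ ‖c‖ → 2 * R < ‖c‖ := fun hc => by linarith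
  -- deep inputs for both frames
  have hU1 := hU J R Z W eZ eW hR hJs hJ2 hF1 hJZ hJW
  have hEL1 : HasEmbeddedLimits J R Z W :=
    helper_embeddedLimitsOfImmersed J R Z W hJs hJ2 (hIL J R Z W eZ eW hR hJs hJ2 hF1 hJZ hJW)
  have hU' := hU J R W Z eW eZ hR hJs hJ2 hF2 hJW hJZ
  have hEL' : HasEmbeddedLimits J R W Z :=
    helper_embeddedLimitsOfImmersed J R W Z hJs hJ2 (hIL J R W Z eW eZ hR hJs hJ2 hF2 hJW hJZ)
  have hLF1 := hLF J R Z W eZ eW hR hJs hJ2 hF1 hJZ hJW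
  have hLF' := hLF J R W Z eW eZ hR hJs hJ2 hF2 hJW hJZ
  rcases helper_continuityOfUniqueness J R Z W eZ eW hR hJs hJ2 hF1 hJZ hJW hLF1 hU1 hEL1 with
    ⟨F, hFs, hFb, hFd, hFm, hF5, hF5'⟩ | hblow
  · rcases helper_continuityOfUniqueness J R W Z eW eZ hR hJs hJ2 hF2 hJW hJZ hLF' hU' hEL' with
      ⟨G, hGs, hGb, hGd, hGm, hG5, hG5'⟩ | hblow
    · left
      refine ⟨F, G, hFs, hGs, hFb, hGb, hFd, hGd, fun b => (hFm b).2.1, fun c => (hGm c).2.1,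
        ?_, ?_, ?_, ?_, ?_, ?_, ?_, ?_, ?_, ?_, ?_⟩
      · intro b hb ξ; rw [← hW]; exact hF5 b hb ξ
      · intro x hx; rw [← hW] at hx ⊢; exact hF5' x hx
      · intro c hc η; rw [← hZ]; exact hG5 c hc η
      · intro x hx; rw [← hZ] at hx ⊢; exact hG5' x hx
      · intro b c hc; simp only [← hZ]; exact (hFm b).2.2.2.2.2.2.1 c (h23 hc)
      · intro b ξ h; simp only [← hZ] at h ⊢; exact (hFm b).2.2.2.2.2.2.2 ξ (h23 h)
      · intro c b hb; simp only [← hW]; exact (hGm c).2.2.2.2.2.2.1 b (h23 hb)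
      · intro c η h; simp only [← hW] at h ⊢; exact (hGm c).2.2.2.2.2.2.2 η (h23 h)
      · intro b; simp only [← hW]; exact (hFm b).2.2.2.2.1
      · intro c; simp only [← hZ]; exact (hGm c).2.2.2.2.1
      · intro b ξ c η hx v v' hv
        exact stub_transversePencil J R Z W eZ eW hR hJs hJ2 hF1 hJZ hJW F hFs hFb hFd hFm hF5 hF5'
          c (G c) (hGm c) b ξ η hx v v' hv
    · exact Or.inr hblow
  · exact Or.inr hblow

/-- **The crux reduces to local families, uniqueness of members and immersed limits.**
`TameOrBrodyR4` by name from `HasLocalFamilies`, uniqueness of members and immersed limits for every admissible `(J, R, frame)`: `J`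
standard on `‖x‖ ≥ R` is standard on `‖x‖ ≥ 3R`; the research core at radius `3R`
(`pencilsOrBlowup₃_of_deep3`) feeds the landed reduction `Reduction.anchorsOrBlowup_of` at radius
`3R`, then the pencil chart (`stub_chartOfAnchors`), taming (`stub_chartTames`) and gluing
(`stub_gluing`) — disjunct 1; blow-up data give a bounded non-constant entire `J`-curve
(`helper_curveOfBlowup`) — disjunct 2. -/
theorem TameOrBrodyR4_of_deep3i
    (hLF : ∀ (J : E4 → E4 →L[ℝ] E4) (R : ℝ) (P Q : E4 →L[ℝ] ℂ) (eP eQ : ℂ →L[ℝ] E4),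
      0 < R → ContDiff ℝ ∞ J → (∀ x v, J x (J x v) = -v) → IsCoordFrame P Q eP eQ →
      (∀ x : E4, R ≤ ‖x‖ → ∀ v, P (J x v) = Complex.I * P v) →
      (∀ x : E4, R ≤ ‖x‖ → ∀ v, Q (J x v) = Complex.I * Q v) → HasLocalFamilies J R P Q)
    (hU : ∀ (J : E4 → E4 →L[ℝ] E4) (R : ℝ) (P Q : E4 →L[ℝ] ℂ) (eP eQ : ℂ →L[ℝ] E4),
      0 < R → ContDiff ℝ ∞ J → (∀ x v, J x (J x v) = -v) → IsCoordFrame P Q eP eQ →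
      (∀ x : E4, R ≤ ‖x‖ → ∀ v, P (J x v) = Complex.I * P v) →
      (∀ x : E4, R ≤ ‖x‖ → ∀ v, Q (J x v) = Complex.I * Q v) →
      ∀ (b : ℂ) (u u' : ℂ → E4), IsPencilMember J R P Q b u → IsPencilMember J R P Q b u' → u = u')
    (hIL : ∀ (J : E4 → E4 →L[ℝ] E4) (R : ℝ) (P Q : E4 →L[ℝ] ℂ) (eP eQ : ℂ →L[ℝ] E4),
      0 < R → ContDiff ℝ ∞ J → (∀ x v, J x (J x v) = -v) → IsCoordFrame P Q eP eQ →
      (∀ x : E4, R ≤ ‖x‖ → ∀ v, P (J x v) = Complex.I * P v) →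
      (∀ x : E4, R ≤ ‖x‖ → ∀ v, Q (J x v) = Complex.I * Q v) →
      ∀ (b : ℕ → ℂ) (u : ℕ → ℂ → E4) (bs : ℂ) (v : ℂ → E4),
      (∀ n, IsPencilMember J R P Q (b n) (u n)) → Tendsto b atTop (𝓝 bs) →
      ContDiff ℝ ∞ v → IsJHolomorphicFlat J v →
      TendstoLocallyUniformly u v atTop →
      TendstoLocallyUniformly (fun n => fderiv ℝ (u n)) (fderiv ℝ v) atTop →
      Tendsto (fun ξ => Q (v ξ)) (cocompact ℂ) (𝓝 bs) →
      Tendsto (fun ξ => P (v ξ) - ξ) (cocompact ℂ) (𝓝 0) →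
      (∀ c : ℂ, 2 * R < ‖c‖ → ∃! ξ, P (v ξ) = c) →
      (∀ ξ : ℂ, 2 * R < ‖P (v ξ)‖ → Function.Bijective (fderiv ℝ (fun ξ => P (v ξ)) ξ)) →
      ∀ ξ : ℂ, Function.Injective (fderiv ℝ v ξ)) :
    Summit.SmoothPoincare4.SmoothPoincare4.Theses.SullivanDual.TameOrBrodyR4 := by
  intro J R hR hJs hJ2 hJi
  have hR3 : 0 < 3 * R := by positivity
  have hJi3 : ∀ x : E4, 3 * R ≤ ‖x‖ → ∀ a b : E4, ⟪J x a, b⟫_ℝ = stdSymplecticForm a b :=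
    fun x hx => hJi x (by linarith)
  rcases Reduction.anchorsOrBlowup_of J (3 * R) hR3 hJi3
      (pencilsOrBlowup₃_of_deep3i hLF hU hIL J R hR hJs hJ2 hJi) with
    ⟨b, c, hb, hc, hbs, hcs, hbJ, hcJ, htr, hch, hbh, hbD, hcD, hC⟩ |
    ⟨K, f, hK, hf, hfJ, hfK, hblow⟩
  · left
    obtain ⟨Φ, hΦ, hbij, hA, hB, hposA, hposB, hD, hC'⟩ :=
      stub_chartOfAnchors J (3 * R) hJs hJ2 hJi3 b c hb hc hbs hcs hbJ hcJ htr hch hbh hbD hcD hC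
    exact stub_gluing J (3 * R) hR3 hJi3 Φ hΦ hD hC' (stub_chartTames J Φ hbij hA hB hposA hposB)
  · right
    obtain ⟨u, hu⟩ := helper_curveOfBlowup J hJs hJ2 K f hK hf hfJ hfK hblow
    exact ⟨u, hu.1, hu.2.1, hu.2.2.1, hu.2.2.2⟩

/-- **Registered helper `helper_reductionToLocalUniqueImmersed`** (arrow form of
`TameOrBrodyR4_of_deep3i`): local families ⇒ uniqueness of members ⇒ immersed limits ⇒ crux.
Transversality, disjointness of members and injectivity of limits are no longer hypotheses. -/
theorem helper_reductionToLocalUniqueImmersed :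
    (∀ (J : E4 → E4 →L[ℝ] E4) (R : ℝ) (P Q : E4 →L[ℝ] ℂ) (eP eQ : ℂ →L[ℝ] E4),
      0 < R → ContDiff ℝ ∞ J → (∀ x v, J x (J x v) = -v) → IsCoordFrame P Q eP eQ →
      (∀ x : E4, R ≤ ‖x‖ → ∀ v, P (J x v) = Complex.I * P v) →
      (∀ x : E4, R ≤ ‖x‖ → ∀ v, Q (J x v) = Complex.I * Q v) → HasLocalFamilies J R P Q) →
    (∀ (J : E4 → E4 →L[ℝ] E4) (R : ℝ) (P Q : E4 →L[ℝ] ℂ) (eP eQ : ℂ →L[ℝ] E4),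
      0 < R → ContDiff ℝ ∞ J → (∀ x v, J x (J x v) = -v) → IsCoordFrame P Q eP eQ →
      (∀ x : E4, R ≤ ‖x‖ → ∀ v, P (J x v) = Complex.I * P v) →
      (∀ x : E4, R ≤ ‖x‖ → ∀ v, Q (J x v) = Complex.I * Q v) →
      ∀ (b : ℂ) (u u' : ℂ → E4), IsPencilMember J R P Q b u → IsPencilMember J R P Q b u' → u = u') →
    (∀ (J : E4 → E4 →L[ℝ] E4) (R : ℝ) (P Q : E4 →L[ℝ] ℂ) (eP eQ : ℂ →L[ℝ] E4),
      0 < R → ContDiff ℝ ∞ J → (∀ x v, J x (J x v) = -v) → IsCoordFrame P Q eP eQ →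
      (∀ x : E4, R ≤ ‖x‖ → ∀ v, P (J x v) = Complex.I * P v) →
      (∀ x : E4, R ≤ ‖x‖ → ∀ v, Q (J x v) = Complex.I * Q v) →
      ∀ (b : ℕ → ℂ) (u : ℕ → ℂ → E4) (bs : ℂ) (v : ℂ → E4),
      (∀ n, IsPencilMember J R P Q (b n) (u n)) → Tendsto b atTop (𝓝 bs) →
      ContDiff ℝ ∞ v → IsJHolomorphicFlat J v →
      TendstoLocallyUniformly u v atTop →
      TendstoLocallyUniformly (fun n => fderiv ℝ (u n)) (fderiv ℝ v) atTop →
      Tendsto (fun ξ => Q (v ξ)) (cocompact ℂ) (𝓝 bs) →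
      Tendsto (fun ξ => P (v ξ) - ξ) (cocompact ℂ) (𝓝 0) →
      (∀ c : ℂ, 2 * R < ‖c‖ → ∃! ξ, P (v ξ) = c) →
      (∀ ξ : ℂ, 2 * R < ‖P (v ξ)‖ → Function.Bijective (fderiv ℝ (fun ξ => P (v ξ)) ξ)) →
      ∀ ξ : ℂ, Function.Injective (fderiv ℝ v ξ)) →
    Summit.SmoothPoincare4.SmoothPoincare4.Theses.SullivanDual.TameOrBrodyR4 :=
  fun hLF hU hIL => TameOrBrodyR4_of_deep3i hLF hU hIL

end Summit.SmoothPoincare4.SmoothPoincare4.Cruxes.TameOrBrodyR4.Sketch
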